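import Summits.NavierStokesRegularity.NavierStokesRegularity.Theorems.SwirlFreeBudgetSmoothCore
import Summits.NavierStokesRegularity.NavierStokesRegularity.Theorems.SwirlFreeBudgetEnstrophyGauge
import Literature.Analysis.FluidPDE.NSLerayHopfSereginMild
import HarnessLib

/-!
# SwirlFreeBudget, crux K-18.2 (T-18.5): the smooth-case bound in the FULL CKN GAUGE — `P₀` for
# SMOOTH swirl-free solutions, conditional on `EtaMoserBound` (seat nsreg-p4)

Support file for the DORMANT route `SwirlThreshold` (crux stmt-NavierStokesRegularity-2002) and
planner nsreg-p2's ROUND-18 assembly `EtaMoserBound → SwirlFreePolynomialBound`.  Combines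
`velocity_bound_of_etaMoserBound` (part `…SmoothCore`, gauges `A`, `E` at scale `R/2`) with
`cknE_half_le_of_cknC_cknD` (part `…EnstrophyGauge`: `E(R/2) ≤ c(1+M)` from `C(R), D(R) ≤ M`, the
smooth slices' classical gradient being a weak spatial gradient, `hasWeakSpatialGradientOn_fderiv`):

* `smooth_velocity_bound_of_gauges`: assuming `EtaMoserBound`, a smooth axisymmetric solution on an
  axis-centred `Q(z₀, R)` whose slices are axisymmetric and swirl free everywhere, with
  `A(R/2), C(R), D(R) ≤ M` at `z₀`, satisfies an explicit bound
  `‖V‖ ≤ K(1+M)^K √(c(1+M))/(4R) + 512 C (vol(B(R/4))/(R/2)³ + M/(R/2)²)` on `Q(z₀, R/16)` —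
  POLYNOMIAL in the critical gauge `M`, no solution-dependent data term.

This is `SwirlFreePolynomialBound` (P₀) for the SMOOTH representative at ONE axis point and ONE
scale; the remaining step of T-18.5 is the reduction suitable-weak → smooth below the first
singular time (tree pattern `…EulerScaling.clean_point_backwardRegular`).
WHAT THIS IS NOT: not NS regularity — conditional on the open K-18.1 `EtaMoserBound`;
`SwirlFreePolynomialBound` itself and all hard cores untouched; no crux claim.
-/

namespace Summit.NavierStokesRegularity.NavierStokesRegularity.Theorems.SwirlFreeBudget

open Set Filter Topology Metric MeasureTheory TopologicalSpace
open scoped ENNReal NNReal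
open Literature.Analysis Literature.Analysis.FluidPDE
open Literature.Analysis.FluidPDE.SereginZajaczkowski2007

noncomputable section

/-- **P₀ FOR SMOOTH SOLUTIONS, in the full CKN gauge, conditional on `EtaMoserBound`.** -/
theorem smooth_velocity_bound_of_gauges (hEta : EtaMoserBound) :
    ∃ K C c : ℝ, 0 < K ∧ 0 ≤ C ∧ 0 ≤ c ∧
      ∀ (V : ℝ → EuclideanSpace ℝ (Fin 3) → EuclideanSpace ℝ (Fin 3))
        (P : ℝ → EuclideanSpace ℝ (Fin 3) → ℝ) (z₀ : ℝ × EuclideanSpace ℝ (Fin 3)) (R : ℝ),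
        0 < R → cylRadius z₀.2 = 0 →
        IsSmoothAxisymmetricSolutionOn (parabolicCylinderOpens R z₀) V P →
        (∀ t, IsAxisymmetric (V t)) → (∀ t, HasNoSwirl (V t)) →
        ∀ M : ℝ, 0 ≤ M →
        cknA (R / 2) z₀ V ≤ ENNReal.ofReal M →
        cknC R z₀ V ≤ ENNReal.ofReal M → cknD R z₀ P ≤ ENNReal.ofReal M →
        ∀ z ∈ parabolicCylinder (R / 16) z₀,
          ‖V z.1 z.2‖ ≤ K * (1 + M) ^ K * Real.sqrt (c * (1 + M)) / (8 * (R / 2)) +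
            512 * C * ((volume (ball z₀.2 (R / 2 / 2))).toReal / (R / 2) ^ 3 + M / (R / 2) ^ 2) := by
  obtain ⟨K, C, hK, hC0, hcore⟩ := velocity_bound_of_etaMoserBound hEta
  obtain ⟨c, hc⟩ := cknE_half_le_of_cknC_cknD
  refine ⟨K, C, (c : ℝ), hK, hC0, NNReal.coe_nonneg c, ?_⟩
  intro V P z₀ R hR haxis hsm hax hsw M hM hA hC hD z hz
  -- the classical gradient is a weak spatial gradient on the cylinder; `E(R/2) ≤ c (1 + M)`
  have hG : HasWeakSpatialGradientOn (parabolicCylinderOpens R z₀) V (fun t x => fderiv ℝ (V t) x) :=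
    hasWeakSpatialGradientOn_fderiv hsm.continuousOn_velocity hsm.continuousOn_fderiv
      (fun w hw => hsm.differentiableAt hw)
  have hE' := hc (parabolicCylinderOpens R z₀) V P _ hsm.suitable hG z₀ R hR
    (by rw [coe_parabolicCylinderOpens]) (ENNReal.ofReal M) hC hD
  have hE : cknE (R / 2) z₀ (fun t x => fderiv ℝ (V t) x) ≤ ENNReal.ofReal ((c : ℝ) * (1 + M)) := by
    refine hE'.trans (le_of_eq ?_)
    rw [ENNReal.ofReal_mul (NNReal.coe_nonneg c), ENNReal.ofReal_coe_nnreal, ENNReal.ofReal_add zero_le_one hM,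
      ENNReal.ofReal_one]
  -- restrict the smooth class to `Q(z₀, R/2)` and apply the smooth-case core there
  have hR2 : 0 < R / 2 := by positivity
  have hle : parabolicCylinderOpens (R / 2) z₀ ≤ parabolicCylinderOpens R z₀ := by
    rw [← SetLike.coe_subset_coe, coe_parabolicCylinderOpens, coe_parabolicCylinderOpens]
    exact parabolicCylinder_subset_of_le hR2.le (by linarith) z₀
  have hsm2 : IsSmoothAxisymmetricSolutionOn (parabolicCylinderOpens (R / 2) z₀) V P := hsm.of_le hle
  have hcE : 0 ≤ (c : ℝ) * (1 + M) := by positivity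
  have hz' : z ∈ parabolicCylinder (R / 2 / 8) z₀ := by
    rw [show R / 2 / 8 = R / 16 by ring]; exact hz
  exact hcore V P z₀ (R / 2) hR2 haxis hsm2 hax hsw M ((c : ℝ) * (1 + M)) hM hcE hA hE z hz'

end

end Summit.NavierStokesRegularity.NavierStokesRegularity.Theorems.SwirlFreeBudget
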